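import Summits.Ventures.CertifiedManyBodySolver.Downfold.EmeryShapeWindowClosureBand
import Summits.Ventures.CertifiedManyBodySolver.Downfold.EmeryFermiScalePointsLa214VirtualCorners
import Summits.Ventures.CertifiedManyBodySolver.Downfold.EmeryFermiScalePointsLa214Corners
import HarnessLib

/-!
# THE ONE-BAND FERMI-SURFACE SHAPE `t′/t` OF THE WHOLE TYPED 3BE BOX `emeryBoxLa214 (EmeryBoxesCuprates)` OVER ITS WHOLE FILLING BAND (two-ray rule + band window closure, §B.86 (k);
# router/EMERY-SHAPE-CORNERS.tsv «band» row)

Venture CertifiedManyBodySolver, cell `pub/hubbard-downfold` (stage S1; INFLATION-RULES-3to1-B §B.86 (k)), seat hubbard-downfold-mod-4 (technique B, g35); namespace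
`Summit.Ventures.CertifiedManyBodySolver.Downfold.Emery`. Everything PROVED (0 sorry). WHAT THIS IS NOT: a statement about La₂₋ₓSrₓCuO₄ (box #18) — the typed box is SCREENING-GRADE;
`U = 0` one-body kinematics of the σ model (rigid band); object E = the EXACT `t–t′` shape of the σ Fermi surface.

**For EVERY one-body row of the box AND EVERY filling of the band x ∈ [0, 0.22] (ν ∈ [39/100, 1/2]; LSCO columns M13–M17), the one-band t′/t of the σ Fermi surface at that row's own Fermi energy lies in
[-0.3104, -0.1583]** (`la214Box_fsRatio_band`) — `fsRatio_fermiEnergyOf_mem_Icc_windowClosure_band` with the end-filling point brackets: lower window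
[ε_F(V_lo; ν₁)⁻, ε_F(A_lo; ν₂)⁺] = [1.6446, 1.9974] (closure lipschitz), upper window [0, ε_F(V_hi; ν₂)⁺] = [0, 1.6728] (monotone), regime at ε_F(H; ν₂)⁺ = 2.435. The per-filling windows of
`EmeryBoxesLa214ShapeCorners` are nested inside (same certificates).

Sources: three-band model [HybertsenSchluterChristensen1989, Eq. (1)]; [AndersenEtAl1995, §6]; box rows as cited in the typed object's file.
-/

noncomputable section

namespace Summit.Ventures.CertifiedManyBodySolver.Downfold.Emery

open Real Set

/-- **La₂₋ₓSrₓCuO₄ (box #18), filling band x ∈ [0, 0.22] (ν ∈ [39/100, 1/2]; LSCO columns M13–M17): for every row of the box and every filling of the band, the one-band Fermi-surface `t′/t` (object E) lies in `[-0.3104, -0.1583]`.** [folklore] -/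
theorem la214Box_fsRatio_band {Δ a b c ν : ℝ} (hΔ : Δ ∈ Icc ((17 : ℝ) / 10) (4 : ℝ)) (ha : a ∈ Icc ((129 : ℝ) / 100) ((38 : ℝ) / 25)) (hb : b ∈ Icc ((23 : ℝ) / 50) ((33 : ℝ) / 50)) (hc : c ∈ Icc ((3 : ℝ) / 25) ((3 : ℝ) / 20)) (hν : ν ∈ Icc ((39 : ℝ) / 100) ((1 : ℝ) / 2)) :
    fsRatio Δ a b c (fermiEnergyOf Δ a b c ν) ∈ Icc ((-194 : ℝ) / 625) ((-1583 : ℝ) / 10000) := by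
  have hV : ((3 : ℝ) / 20) * ((33 : ℝ) / 50) / ((23 : ℝ) / 50) = ((99 : ℝ) / 460) := by norm_num
  have hW : ((3 : ℝ) / 25) * ((23 : ℝ) / 50) / ((33 : ℝ) / 50) = ((23 : ℝ) / 275) := by norm_num
  have hVlo := (fermiEnergyOf_of_pointBracketCheck virtPt_la214Vlo_x022_br (by norm_num) (by norm_num) (by norm_num) (ν := (39/100 : ℝ)) (by push_cast; exact ⟨le_rfl, le_rfl⟩)).2
  have hVhi := (fermiEnergyOf_of_pointBracketCheck virtPt_la214Vhi_x0_br (by norm_num) (by norm_num) (by norm_num) (ν := (1/2 : ℝ)) (by push_cast; exact ⟨le_rfl, le_rfl⟩)).2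
  have hAlo := (fermiEnergyOf_of_pointBracketCheck virtPt_la214Alo_x0_br (by norm_num) (by norm_num) (by norm_num) (ν := (1/2 : ℝ)) (by push_cast; exact ⟨le_rfl, le_rfl⟩)).2
  have hTop := (fermiEnergyOf_of_pointBracketCheck cornerPt_la214BoxHi_x0_br (by norm_num) (by norm_num) (by norm_num) (ν := (1/2 : ℝ)) (by push_cast; exact ⟨le_rfl, le_rfl⟩)).2
  have hLo2 := (fermiEnergyOf_of_pointBracketCheck virtPt_la214Vlo_x022_br (by norm_num) (by norm_num) (by norm_num) (ν := (39/100 : ℝ)) (by push_cast; exact ⟨le_rfl, le_rfl⟩)).2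
  push_cast at hVlo hVhi hAlo hTop
  norm_num at hVlo hVhi hAlo hTop
  refine fsRatio_fermiEnergyOf_mem_Icc_windowClosure_band (Δ₁ := ((17 : ℝ) / 10)) (Δ₂ := (4 : ℝ)) (a₁ := ((129 : ℝ) / 100)) (a₂ := ((38 : ℝ) / 25)) (b₁ := ((23 : ℝ) / 50))
    (b₂ := ((33 : ℝ) / 50)) (c₁ := ((3 : ℝ) / 25)) (c₂ := ((3 : ℝ) / 20)) (e₁ := ((8223 : ℝ) / 5000)) (e₂ := ((9987 : ℝ) / 5000)) (e₃ := 0) (e₄ := ((2091 : ℝ) / 1250)) (ν₁ := ((39 : ℝ) / 100)) (ν₂ := ((1 : ℝ) / 2)) (by norm_num) (by norm_num) (by norm_num) (by norm_num)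
    (by norm_num) hΔ ha hb hc (by norm_num) hν (by norm_num) ?_ ?_ ?_ (by norm_num) ?_ ?_ ?_ (by norm_num) ?_
  · nlinarith [hTop.2]
  · rw [hV]; exact hVlo.1
  · exact hAlo.2
  · intro ε hε
    rw [hV]
    have hlip := fsRatio_ge_on_window (Δ := ((17 : ℝ) / 10)) (a := ((129 : ℝ) / 100)) (b := ((33 : ℝ) / 50)) (c := ((99 : ℝ) / 460)) (p := ((8223 : ℝ) / 5000)) (q := ((9987 : ℝ) / 5000))
      (M := ((3919 : ℝ) / 10000)) (by norm_num) (by norm_num) (by norm_num) (by norm_num) (by norm_num [fsD, fsN]) (by norm_num [dopingDisc]) (by norm_num [dopingDisc]) hε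
    refine le_trans ?_ hlip
    norm_num [fsRatio, fsD, fsN]
  · exact (fermiEnergyOf_pos (by norm_num) (by norm_num) (by norm_num) (by norm_num) (by norm_num) (by norm_num)).le
  · rw [hW]; exact hVhi.2
  · intro ε hε
    rw [hW]
    have hmono := (fsRatio_mem_Icc_on_window_of_dopingDisc_nonpos (Δ := (4 : ℝ)) (a := ((38 : ℝ) / 25)) (b := ((23 : ℝ) / 50)) (c := ((23 : ℝ) / 275))
      (p := 0) (q := ((2091 : ℝ) / 1250)) (by norm_num) (by norm_num) (by norm_num) (by norm_num) (by norm_num) (by norm_num) (by norm_num)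
      (by norm_num [dopingDisc]) hε).2
    refine le_trans hmono ?_
    norm_num [fsRatio, fsD, fsN]

end Summit.Ventures.CertifiedManyBodySolver.Downfold.Emery
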